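/-
Copyright: statement-level skeleton of a published paper (lit-balaban cell, Phase-2 proof seat p18 gen 8). No proof claims
beyond what the kernel checks below.
-/
import Mathlib
import Literature.MathematicalPhysics.QuantumFieldTheory.Balaban1983to89.B3Prop22FreeLines
import Literature.MathematicalPhysics.QuantumFieldTheory.Balaban1983to89.B3Prop21Except24Member

/-!
# B3 — T. Bałaban, *(Higgs)₂,₃ quantum fields in a finite volume. III. Renormalization*, CMP **88** (1983) 411–445
[Balaban1983Higgs3], p. 439 [PDF 29] with Proposition 2.2 p. 428: the generalized graph of **(3.22)** (*"The first graph on the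
right side has positive degree"*) as a WORKED MEMBER of the family of generalized graphs of Proposition 2.2 — the first member
of the tree with TWO lines, hence with two orderings l̃ and a genuine sequence of subgraphs `G′₁ ⊂ G′₂ = G′` along each; the
PRINTED hypothesis of Propositions 2.1/2.2 (*"a sequence of subgraphs G′₁, G′₂, …, G′_m = G defined by an ordering l̃′ … consists
of subgraphs with positive degrees D(G′_i) > 0"*, (3.5) p. 434) holds for it THROUGH POSITIVITY for BOTH orderings

statement-level skeleton of published theorems with citation tags; proofs where landed; nothing here is a claim about
the Yang–Mills mass gap

PDF held: `paper:balaban1983-higgs-2-3-quantum-fields-finite-volume` (journal page = PDF page + 410); pp. 424, 428, 434, 438–439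
[PDF 14, 18, 24, 28–29] read in the OCR text and on the ×4 renders `…/1983-cmp88-higgs23-III-p028-x4.png`, `…-p029-x4.png`.

CITATION HEADER (lean-in-tree rule).  Part of the lit-balaban TYPED SKELETON (HOME `run/shared/lean/pub/lit-balaban/`), PHASE 2,
seat p18 generation 8; companion of `B3Eq322OneLegDifferentiated` / `B3Eq322PositiveDegree` (the expression `rem322` of this
generalized graph and its (3.13)-type estimate with the gain `(L^{j₁}η)^α`).  WHAT IS REPRODUCED: rows **B3.Eq3.21-3.24** (sub-display
(3.22)) and **B3.Prop2.2** (a further located member) of `HOME/lit-balaban-r15/ROWS-B3.md` (fold owner r15, referee ref-4).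
CONSUMES BY NAME, nothing re-proved: p19's count-data calculus `B3Ineq215.Counts`/`Model` (`rep`, `reps`, `before`, `fiber`,
`Nontriv`), `B3Ineq213.degQ`/`lineDimQ`/`legExpQ`/`Component`/`relabelCounts`/`LinesConnect`, p19's `params24` (`d = 3`, `L = 2`,
`δ₁ = 1`), and seat p18 gen 7's generalized family `B3FreeLine` (`ParamsK`, `CGraphK`, `DatumK`, `expansionK`, `famK`, `degQK`,
`Is24K`, `prop21_freeLines : Prop21 (famK P mbar)`), exactly as the one-line worked members `B3FreeLine.memberK24` (gen 7) do.

THE PRINTED TEXT (verbatim).  p. 439: *"The first graph on the right side [of (3.22): the second graph of (3.21) with the vertex label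
+α and the leg label −(1+α)] has positive degree"*.  p. 438: *"All the remaining divergent graphs of this type have degrees equal to
0."*  p. 428 (Proposition 2.2): *"Let us consider a family of generalized graphs (i.e. graphs with arbitrary numbers of legs and powers
of η in vertices, lines with the same exponential factors but with arbitrary dimensions instead of −d+2)."*  p. 434, (3.5): *"γ(G′,l̃′)
is a characteristic function of some set of orderings l̃′. This set has the property that a sequence of subgraphs G′₁, G′₂, …, G′_m = G
defined by an ordering l̃′ from the set consists of subgraphs with positive degrees D(G′_i) > 0."*

WHAT IS PROVED, and how.  The COUNT DATUM `graph322` of the second graph of (3.21) (p18 g3's picture `B3Sect3LowestOrderGraphs.g321b`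
read as p19's `Counts`: vertices `0 = x`, `1 = x′`; line `0` = the scalar line `G_{(j)}(0)` from `x` to `x′` carrying the one
differentiation of the vertex `x`; line `1` = the vector line `G_{(j′)}`; vertices (1.8)_{1,0}, η-power `0`; `d = 3`) with the extra
line dimension `κ = (α, 0)`, `α = ½` (*"e.g. if we take α₀ = ½"*, p. 421) — the weight `|x−x′|^α` of `rem322` sits on the kernel and
raises the dimension of the scalar line by `α` (`B3Eq322PositiveDegree.exp_mul_rpow_le`: it costs `(L^{j₁}η)^α` against half of the
decay).  For EVERY ordering `σ` of the two lines (`relabelCounts graph322 σ`): after the first line both vertices are one block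
(`rep_one`, `rep_two`; both lines join `x` and `x′`), the blocks are `G′₁` (line `σ 0`) and `G′₂ = G′` (`block_graph322`); the line
dimensions are `a = −(d−2) − 1 = −2` (scalar, differentiated once) and `−(d−2) = −1` (vector) (`lineDimQ_relabel`); the degrees (2.2):
`D(G′₁) = 3 + a_{σ0}` = `1` if the scalar line comes first, `2` if the vector line does (`degQ_one`), **`D(G′) = 0`** (`degQ_two` —
the printed *"degrees equal to 0"*), and the generalized degrees `D_K(G′₁) = 3/2` resp. `2`, **`D_K(G′) = ½ = α > 0`** (`degQK_one`,
`degQK_two` — *"has positive degree"*).  Hence **`posSubgraphsExcept24_memberK322`**: r15's PRINTED hypothesis `PosSubgraphsExcept24`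
holds for the member through positivity, for both orderings and every block (`γ(G′,l̃′) ≡ 1` for this generalized graph), no block
being exceptional (`not_is24_memberK322`); and **`ineq133_memberK322`**: (1.33) for this generalized graph as asserted by
`prop21_freeLines` (the family's `O(1)(n̄)`).
HONEST SCOPE: a member of the ABSTRACT-amplitude family `famK` (amplitudes = any `IBPAmpK` datum satisfying the class budgets; the
genuine-propagator family `famZK` of gen 7 has `κ ≤ 0` lines only — the `α`-raised line of (3.22) is the WEIGHTED kernel
`(∂^η_μG_{(j)}(0))(x,x′)|x−x′|^α`, whose (2.10)-type bound at dimension `1−d+α` and rate `δ/2` is `B3Eq322PositiveDegree`'s weight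
lemma, not a kernel of the tower); `d = 3`, `L = 2`, `δ₁ = 1`, menu `{0, ½}`; external legs live in the amplitude's vertex functions (as
in all of p19's/gen-7's members).  D-0026: definitions with bodies (the datum, the parameters, the member) + theorems; no named facts,
no `sorry`; standard axioms.  Unit `lit-balaban-p18-g8` (literature-prover-lit-balaban-p18-g8-0), HOME
`run/shared/lean/pub/lit-balaban/`, 2026-08-21.
-/

open Finset

namespace Literature.MathematicalPhysics.QuantumFieldTheory.Balaban1983to89.B3Eq322Member

open B3Ineq215 B3Ineq213 B3Sect2FirstEstimate B3Prop1 B3FreeLine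

/-! ## The count datum of the second graph of (3.21) -/

/-- **The second graph of (3.21)** p. 438 [PDF 28] as a count datum (`d = 3`, `L = 2`, `δ₁ = 1`): vertices `0` (= `x`) and `1`
(= `x′`); line `0` = the scalar line `G_{(j)}(0)` from `x` to `x′` carrying the ONE differentiation of the vertex `x` (the kernel
`(∂^η_μG_{(j)}(0))(x,x′)` of (3.23)); line `1` = the vector line `G_{(j′)}(x,x′)`; no averaged vector legs; η-powers `0` (vertices
(1.8) with `n + n′ = 1`). [cite: Balaban1983Higgs3, (3.21) p.438] -/
noncomputable def graph322 : Counts (Fin 2) 2 where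
  src := fun _ => 0
  tgt := fun _ => 1
  touches := fun v => ⟨0, by fin_cases v <;> simp⟩
  diffOn := fun v l => if v = 0 ∧ l = 0 then 1 else 0
  vecLegAvg := fun _ _ => 0
  etaPow := fun _ => 0
  d := 3
  L := 2
  δ₁ := 1
  d_pos := by norm_num
  two_le_L := le_rfl
  δ₁_pos := one_pos

/-- **The extra line dimensions of the generalized graph of (3.22)**: `+α` on the scalar line (the weight `|x−x′|^α` of `rem322`),
`α = ½`; the vector line keeps its standard dimension. [cite: Balaban1983Higgs3, (3.22) p.439] -/
def κ322 : Fin 2 → ℚ := fun l => if l = 0 then 1 / 2 else 0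

/-- The constants of the example family: p19's `params24` (`d = 3`, `L = 2`, `δ₁ = 1`, bounds `Cmax`, `CD`) and the menu `{0, ½}`
of extra line dimensions. [cite: Balaban1983Higgs3, Prop. 2.2 p.428] -/
def paramsK322 (Cmax CD : ℝ) : ParamsK where
  toParamsIBP := params24 Cmax CD
  menu := {0, 1 / 2}

/-- The menu contains both exponents used. [cite: Balaban1983Higgs3, Prop. 2.2 p.428] -/
theorem κ322_mem_menu (Cmax CD : ℝ) (l : Fin 2) : κ322 l ∈ (paramsK322 Cmax CD).menu := by
  unfold κ322 paramsK322
  split_ifs <;> simp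

/-- The second graph of (3.21) is connected: each of its lines joins its two vertices. [cite: Balaban1983Higgs3, (3.21) p.438] -/
theorem linesConnect_graph322 : LinesConnect graph322.src graph322.tgt := by
  have h01 : Relation.EqvGen (fun a b : Fin 2 => ∃ l, graph322.src l = a ∧ graph322.tgt l = b) 0 1 :=
    Relation.EqvGen.rel _ _ ⟨0, rfl, rfl⟩
  intro u w
  fin_cases u <;> fin_cases w
  · exact Relation.EqvGen.refl _
  · exact h01
  · exact h01.symm
  · exact Relation.EqvGen.refl _

/-- **The generalized graph of (3.22) is a member of the family of Proposition 2.2** (`famK`, gen 7) at every size bound `mb ≥ 2`.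
[cite: Balaban1983Higgs3, Prop. 2.2 p.428] -/
noncomputable def memberK322 (Cmax CD : ℝ) {mb : ℕ} (h : 2 ≤ mb) : CGraphK (paramsK322 Cmax CD) mb where
  n := 2
  m := 2
  m_le := h
  G := graph322
  d_eq := rfl
  L_eq := rfl
  δ₁_eq := rfl
  conn := linesConnect_graph322
  κ := κ322
  κ_mem := κ322_mem_menu Cmax CD

/-! ## The two orderings: blocks, line dimensions and degrees -/

/-- kernel: an element of `Fin 2` is `0` or `1`. [folklore] -/
private theorem fin_two_eq (i : Fin 2) : i = 0 ∨ i = 1 := by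
  fin_cases i <;> simp

/-- Along EITHER ordering `σ`, after the first line the two vertices form one block represented by `x = 0` (both lines join `x`
and `x′`). [cite: Balaban1983Higgs3, (2.16) p.428] -/
theorem rep_one (σ : Equiv.Perm (Fin 2)) (v : Fin 2) : (relabelCounts graph322 σ).toModel.rep 1 v = 0 := by
  rw [(relabelCounts graph322 σ).toModel.rep_succ Nat.zero_lt_two v]
  unfold Model.rho Model.bs Model.bt
  simp only [Model.rep_zero]
  fin_cases v <;> simp [graph322, relabelCounts, Counts.toModel]

/-- … and the second line does not change the block (`G′₂ = G′` has the same two vertices). [cite: Balaban1983Higgs3, (2.16) p.428] -/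
theorem rep_two (σ : Equiv.Perm (Fin 2)) (v : Fin 2) : (relabelCounts graph322 σ).toModel.rep 2 v = 0 := by
  rw [(relabelCounts graph322 σ).toModel.rep_succ Nat.one_lt_two v]
  unfold Model.rho Model.bs Model.bt
  simp only [rep_one]
  split_ifs <;> rfl

/-- The block `G′₁` is the whole vertex set. [cite: Balaban1983Higgs3, (2.16) p.428] -/
theorem fiber_one (σ : Equiv.Perm (Fin 2)) : (relabelCounts graph322 σ).toModel.fiber 1 0 = univ := by
  ext v; simp [Model.mem_fiber, rep_one]

/-- The block `G′₂ = G′` is the whole vertex set. [cite: Balaban1983Higgs3, (2.16) p.428] -/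
theorem fiber_two (σ : Equiv.Perm (Fin 2)) : (relabelCounts graph322 σ).toModel.fiber 2 0 = univ := by
  ext v; simp [Model.mem_fiber, rep_two]

/-- The line set of `G′₁` is the first line of the ordering. [cite: Balaban1983Higgs3, (2.16) p.428] -/
theorem before_one (σ : Equiv.Perm (Fin 2)) : (relabelCounts graph322 σ).toModel.before 1 0 = {0} := by
  ext l
  simp only [Model.mem_before, rep_one, and_true, mem_singleton]
  constructor
  · intro h; exact Fin.ext (by simpa using h)
  · intro h; rw [h]; exact Nat.zero_lt_one

/-- The line set of `G′₂ = G′` is both lines. [cite: Balaban1983Higgs3, (2.16) p.428] -/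
theorem before_two (σ : Equiv.Perm (Fin 2)) : (relabelCounts graph322 σ).toModel.before 2 0 = univ := by
  ext l
  simp only [Model.mem_before, rep_two, and_true, mem_univ, iff_true]
  exact l.isLt

/-- The only non-trivial blocks along an ordering are those of `G′₁` and `G′₂` (indices `1`, `2`), both represented by `x = 0`.
[cite: Balaban1983Higgs3, Prop. 2.1 p.424] -/
theorem block_graph322 {σ : Equiv.Perm (Fin 2)} {i : Fin 3} {b : Fin 2}
    (hb : b ∈ (relabelCounts graph322 σ).toModel.reps (i : ℕ)) (hn : (relabelCounts graph322 σ).toModel.Nontriv (i : ℕ) b) :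
    ((i : ℕ) = 1 ∨ (i : ℕ) = 2) ∧ b = 0 := by
  have hi : (i : ℕ) = 0 ∨ (i : ℕ) = 1 ∨ (i : ℕ) = 2 := by have := i.isLt; omega
  rcases hi with hi | hi | hi
  · rw [hi] at hn
    exact absurd hn (by simp [Model.Nontriv, Model.before_zero])
  · refine ⟨Or.inl hi, ?_⟩
    rw [hi] at hb
    have := (relabelCounts graph322 σ).toModel.mem_reps.1 hb
    rw [rep_one] at this
    exact this.symm
  · refine ⟨Or.inr hi, ?_⟩
    rw [hi] at hb
    have := (relabelCounts graph322 σ).toModel.mem_reps.1 hb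
    rw [rep_two] at this
    exact this.symm

/-- **The line dimensions (2.14)**: `a = −(d−2) − 1 = −2` for the scalar line (two legs of dimension `−½`, one differentiation)
and `a = −(d−2) = −1` for the vector line — along the ordering `σ`, the line `i` is the old line `σ i`. [cite: Balaban1983Higgs3, (2.14) p.427] -/
theorem lineDimQ_relabel (σ : Equiv.Perm (Fin 2)) (i : Fin 2) :
    lineDimQ (relabelCounts graph322 σ) i = if σ i = 0 then -2 else -1 := by
  unfold lineDimQ legExpQ Counts.legsOn
  simp only [relabelCounts, graph322, Fin.sum_univ_two]
  rcases fin_two_eq (σ i) with h | h <;> simp [h] <;> norm_num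

/-- **(2.2) for the subgraph `G′₁`** (the first line of the ordering with both vertices): `D(G′₁) = (3+0) + (3+0) − 3 + a_{σ0}`
= `1` if the scalar line comes first, `2` if the vector line does. [cite: Balaban1983Higgs3, (2.2) p.423] -/
theorem degQ_one (σ : Equiv.Perm (Fin 2)) :
    degQ (relabelCounts graph322 σ) 1 0 = if σ 0 = 0 then 1 else 2 := by
  unfold degQ
  rw [fiber_one, before_one, sum_singleton, lineDimQ_relabel]
  simp only [relabelCounts, graph322, Fin.sum_univ_two, Nat.cast_ofNat, Nat.cast_zero, add_zero]
  split_ifs <;> norm_num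

/-- **p. 438 "All the remaining divergent graphs of this type have degrees equal to 0"** for the second graph of (3.21), by (2.2):
`D(G′) = (3+0) + (3+0) − 3 + (−2) + (−1) = 0`, along either ordering. [cite: Balaban1983Higgs3, (3.21) p.438] -/
theorem degQ_two (σ : Equiv.Perm (Fin 2)) : degQ (relabelCounts graph322 σ) 2 0 = 0 := by
  unfold degQ
  rw [fiber_two, before_two]
  have hsum : ∑ l : Fin 2, lineDimQ (relabelCounts graph322 σ) l = -3 := by
    simp only [lineDimQ_relabel]
    rw [Equiv.sum_comp σ (fun i : Fin 2 => if i = 0 then (-2 : ℚ) else -1)]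
    simp [Fin.sum_univ_two]
    norm_num
  rw [hsum]
  simp only [relabelCounts, graph322, Fin.sum_univ_two, Nat.cast_ofNat, Nat.cast_zero, add_zero]
  norm_num

/-- The extra exponents along the ordering: `κ ∘ σ` puts `½` on the position of the scalar line. [cite: Balaban1983Higgs3, (3.22) p.439] -/
theorem κ322_comp (σ : Equiv.Perm (Fin 2)) (i : Fin 2) : (κ322 ∘ σ) i = if σ i = 0 then 1 / 2 else 0 := rfl

/-- **The generalized degree of `G′₁`**: `D_K(G′₁) = D(G′₁) + κ_{σ0}` = `3/2` if the scalar line (dimension raised by `α = ½`) comes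
first, `2` if the vector line does — POSITIVE in both cases. [cite: Balaban1983Higgs3, (3.22) p.439] -/
theorem degQK_one (σ : Equiv.Perm (Fin 2)) :
    degQK (relabelCounts graph322 σ) (κ322 ∘ σ) 1 0 = if σ 0 = 0 then 3 / 2 else 2 := by
  unfold degQK
  rw [degQ_one, before_one, sum_singleton, κ322_comp]
  split_ifs <;> norm_num

/-- **p. 439 "The first graph on the right side has positive degree"**: the generalized degree of the whole graph is
`D_K(G′) = D(G′) + α = 0 + ½ = ½ > 0`, along either ordering. [cite: Balaban1983Higgs3, (3.22) p.439] -/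
theorem degQK_two (σ : Equiv.Perm (Fin 2)) : degQK (relabelCounts graph322 σ) (κ322 ∘ σ) 2 0 = 1 / 2 := by
  unfold degQK
  rw [degQ_two, before_two]
  have hsum : ∑ l : Fin 2, (κ322 ∘ σ) l = 1 / 2 := by
    change ∑ l : Fin 2, κ322 (σ l) = 1 / 2
    rw [Equiv.sum_comp σ κ322]
    simp [κ322]
  rw [hsum, zero_add]

/-- Every non-trivial block along every ordering has POSITIVE generalized degree (`3/2`, `2` or `½`). [cite: Balaban1983Higgs3, (3.22) p.439] -/
theorem degQK_block_pos {σ : Equiv.Perm (Fin 2)} {i : Fin 3} {b : Fin 2}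
    (hb : b ∈ (relabelCounts graph322 σ).toModel.reps (i : ℕ)) (hn : (relabelCounts graph322 σ).toModel.Nontriv (i : ℕ) b) :
    0 < degQK (relabelCounts graph322 σ) (κ322 ∘ σ) i b := by
  obtain ⟨hi, rfl⟩ := block_graph322 hb hn
  rcases hi with hi | hi
  · rw [hi, degQK_one]
    split_ifs <;> norm_num
  · rw [hi, degQK_two]
    norm_num

/-- No block of the member is a (2.4)-block of the generalized graph: the degrees `D(G′₁) ∈ {1, 2}` are not `0`, and `G′₂` has two
lines. [cite: Balaban1983Higgs3, (2.4) p.424] -/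
theorem not_is24K_block {σ : Equiv.Perm (Fin 2)} {i : Fin 3} {b : Fin 2}
    (hb : b ∈ (relabelCounts graph322 σ).toModel.reps (i : ℕ)) (hn : (relabelCounts graph322 σ).toModel.Nontriv (i : ℕ) b) :
    ¬ Is24K (relabelCounts graph322 σ) (κ322 ∘ σ) i b := by
  obtain ⟨hi, rfl⟩ := block_graph322 hb hn
  rintro ⟨⟨hdeg, l, -, -, hbefore⟩, -⟩
  rcases hi with hi | hi
  · rw [hi, degQ_one] at hdeg
    split_ifs at hdeg <;> norm_num at hdeg
  · rw [hi, before_two] at hbefore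
    have h0 : (0 : Fin 2) ∈ ({l} : Finset (Fin 2)) := by rw [← hbefore]; exact mem_univ _
    have h1 : (1 : Fin 2) ∈ ({l} : Finset (Fin 2)) := by rw [← hbefore]; exact mem_univ _
    rw [mem_singleton] at h0 h1
    exact absurd (h0.trans h1.symm) (by decide)

/-! ## The printed hypothesis and (1.33) for the member -/

/-- **The PRINTED hypothesis of Propositions 2.1/2.2 holds for the generalized graph of (3.22) THROUGH POSITIVITY, for both
orderings** — *"a sequence of subgraphs G′₁, G′₂, …, G′_m = G defined by an ordering l̃′ … consists of subgraphs with positive degrees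
D(G′_i) > 0"* ((3.5) p. 434: here `γ(G′,l̃′) = 1` for every ordering). [cite: Balaban1983Higgs3, Prop. 2.2 p.428] -/
theorem posSubgraphsExcept24_memberK322 (Cmax CD : ℝ) {mb : ℕ} (h : 2 ≤ mb) (D : DatumK (paramsK322 Cmax CD)) :
    PosSubgraphsExcept24 (expansionK (paramsK322 Cmax CD) mb D) (memberK322 Cmax CD h) := by
  refine ⟨trivial, ?_⟩
  show ∀ H : Component graph322,
    Is24K (relabelCounts graph322 H.1) (κ322 ∘ H.1) H.2.1 H.2.2.1
      ∨ 0 < degQK (relabelCounts graph322 H.1) (κ322 ∘ H.1) H.2.1 H.2.2.1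
  rintro ⟨σ, i, b, hb, hn⟩
  right
  exact degQK_block_pos hb hn

/-- … every block meeting the hypothesis by positivity, none through the exception (2.4). [cite: Balaban1983Higgs3, Prop. 2.2 p.428] -/
theorem not_is24_memberK322 (Cmax CD : ℝ) {mb : ℕ} (h : 2 ≤ mb) (D : DatumK (paramsK322 Cmax CD)) :
    ∀ H : (expansionK (paramsK322 Cmax CD) mb D).Sub (memberK322 Cmax CD h),
      ¬ (expansionK (paramsK322 Cmax CD) mb D).Is24 (memberK322 Cmax CD h) H := by
  show ∀ H : Component graph322, ¬ Is24K (relabelCounts graph322 H.1) (κ322 ∘ H.1) H.2.1 H.2.2.1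
  rintro ⟨σ, i, b, hb, hn⟩
  exact not_is24K_block hb hn

/-- All subgraph degrees of the member are positive (the exception-free form of the hypothesis holds as well).
[cite: Balaban1983Higgs3, Prop. 2.2 p.428] -/
theorem posSubgraphs_memberK322 (Cmax CD : ℝ) {mb : ℕ} (h : 2 ≤ mb) (D : DatumK (paramsK322 Cmax CD)) :
    ∀ H : (expansionK (paramsK322 Cmax CD) mb D).Sub (memberK322 Cmax CD h),
      0 < (expansionK (paramsK322 Cmax CD) mb D).subDeg (memberK322 Cmax CD h) H := by
  show ∀ H : Component graph322, 0 < degQK (relabelCounts graph322 H.1) (κ322 ∘ H.1) H.2.1 H.2.2.1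
  rintro ⟨σ, i, b, hb, hn⟩
  exact degQK_block_pos hb hn

/-- **(1.33) for the generalized graph of (3.22)**, as asserted by gen 7's `prop21_freeLines` (the constant `O(1)(n̄)` of the family
at the size bound `m̄(n̄) ≥ 2`): for every datum, every localization and all external-field data — Proposition 2.2 APPLIES to the
first graph of the right side of (3.22). [cite: Balaban1983Higgs3, Prop. 2.2 p.428] -/
theorem ineq133_memberK322 (Cmax CD : ℝ) (mbar : ℕ → ℕ) (nbar : ℕ) (h : 2 ≤ mbar nbar) (α₀ : ℝ) (h0 : 0 < α₀)
    (h1 : α₀ < 1) :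
    ∃ δ₀ C : ℝ, 0 < δ₀ ∧ 0 < C ∧ ∀ D : DatumK (paramsK322 Cmax CD),
      Ineq133At (famK (paramsK322 Cmax CD) mbar nbar D).toExpansion
        ((famK (paramsK322 Cmax CD) mbar nbar D).single (memberK322 Cmax CD h)) α₀ δ₀ C := by
  obtain ⟨δ₀, hδ₀, H⟩ := prop21_freeLines (paramsK322 Cmax CD) mbar
  obtain ⟨C, hC, HC⟩ := H α₀ h0 h1 nbar
  exact ⟨δ₀, C, hδ₀, hC, fun D => HC D _ (posSubgraphsExcept24_memberK322 Cmax CD h D)⟩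

end Literature.MathematicalPhysics.QuantumFieldTheory.Balaban1983to89.B3Eq322Member
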